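/-
Copyright: the b2b-balaban T⁴-continuum CRUX team, row NE7b OWNER lineage `t4-ne7b-p1` (gen 125). Project licence.
-/
import Summits.QuantumFields.BalabanUV.T4Continuum.Spine.NE7b.SupZdPerturbedCoarseForm
import Summits.QuantumFields.BalabanUV.T4Continuum.Spine.NE7b.SupZdCoarseInverseOperator

/-!
# THE `H + K` COLUMN'S FLUCTUATION COVARIANCE ANNIHILATES BLOCK SOURCES — `C_KQ′* = 0` ON `ℤ^d`: for ANY perturbed block columns `Ψ^K`
# of block profile `C_Ψe^{−μ|blk n p − c|₁}` and ANY decaying LEFT inverse `N` of the perturbed coarse operator `T_K(b,c) =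
# (n+1)^{−d}Σ_{q ∈ B n b}Ψ^K_c(q)` ((222)'s clauses (A)∕(C)), every `b₀` and `p`: `Σ′_{b″}T_K(b″,b₀)·(Σ′_{b′}N(b′,b″)Ψ^K_{b′}(p)) = Ψ^K_{b₀}(p)` —
# the block means of the solution `u = Ψ^K_{b₀}` of `(H_V + K)u = 𝟙_{B n b₀}` are `T_K(b″,b₀)`, so (221)'s response part `Σ″m(b″)h^K_{b″}` of `u`
# IS `u` and its fluctuation part VANISHES; with (221)'s `Q′C_K = 0` the two projection identities `C_KQ′* = 0 = Q′C_K` of the perturbed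
# road's covariance `C_K = (H+K)⁻¹ − (H+K)⁻¹Q′*(Q′(H+K)⁻¹Q′*)⁻¹Q′(H+K)⁻¹` hold on `ℤ^d`; (209)'s `H + K` twin, as kernel algebra (row NE7b,
# node U5c; (203)∕(234) BY NAME; [folklore])

Cell `pub-balaban`, sub-cell `t4`, spine estimate NE7b (`T4WeightBudget.RelWeightBound`; the cell's OWN estimate — NOT PRINTED in
[Bałaban 1983–89], NOT PROVED).  Crux-route work under `Spine/NE7b/` by the row OWNER (`t4-ne7b-p1` gen 125, file (250)) under FREEZE
(0)'s crux-prover clause; NOTHING of Bałaban's is named as a Lean object, valued or asserted; no `T4Continuum/Support` leaf typed; no `def`,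
no notation (series WRITTEN OUT; `Ψ^K`, `N` ANY data with their displayed properties — (222)∕(246) supply them by name); zero `sorry`.
Imports (BY NAME): the OWNER's (234) `…SupZdPerturbedCoarseForm` (`coarse_entry_le`; through it (191) `natAbs_sub_comm_sum`), (203)
`…SupZdCoarseInverseOperator` (`kernel_comp_apply`), Mathlib's `tsum_eq_single`.

WHY (located).  The fluctuation covariance of the road is the `H + K`-orthogonal complement of the constraint directions: `Q′C_K = 0`
((221), on profile sources) and `C_KQ′* = 0` (block-constant sources have no fluctuation part).  (209) proved the second for the LINEAR
column from the cube limit `M = T_∞⁻¹`; for the `H + K` column ((216)–(249)) it was not typed.  It is one exchange of an absolutely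
convergent double series — `T_K(·,b₀)` decays by the block profile ((234) `coarse_entry_le`), `N` decays, `Ψ^K_{b′}(p)` is bounded in `b′`:
exactly (203) `kernel_comp_apply` — followed by `NT_K = 1`: `Σ′_{b″}T_K(b″,b₀)h^K_{b″}(p) = Σ′_{b′}(Σ′_{b″}N(b′,b″)T_K(b″,b₀))Ψ^K_{b′}(p) =
Σ′_{b′}δ_{b′b₀}Ψ^K_{b′}(p) = Ψ^K_{b₀}(p)`.  Stated for ANY objects with (222)'s displayed clauses, so (222)∕(225)∕(232)∕(246) feed it by name and no
constants need matching.

WHAT IS PROVED ([folklore]): §1 **`perturbed_covariance_kills_block_sources`** (for ALL `n`, `Ψ^K` of block profile, decaying LEFT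
inverses `N` of `T_K`, `b₀`, `p`: the display, i.e. the fluctuation part of `Ψ^K_{b₀}` in (221)'s display is `0`); §2 toy.

HONEST (what this is NOT).  Block sources (block-constant sources by finite superposition — not typed; bounded sources are (211)'s pattern,
not typed for `H + K`); kernel algebra only — the potential, `K` and the equations enter only through (222)'s objects; `d` arbitrary here
(the objects exist for `d ≥ 3` by (222)); scalar skeleton ((A3), NC-NE7b-α UNRULED); nothing of the covariant propagators of [B4]–[B6];
nothing of Bałaban's asserted.  BY-NAME EFFECT ON THE WALL: NONE.  NE7b NOT PRINTED ∕ NOT PROVED; spine PROVED 0∕9; rung (B)+1 — the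
programme's measures remain FINITE-torus statements; NOT the mass gap, NOT Clay.  HONEST DEPENDENCY: continuum YM on T⁴ ⇐ BetaPertH ∧
nine spine estimates (0∕9 proved); BetaPertH ⇐ (D1) ∧ (D4) ∧ CAP+tail; G-an2-4 gates asym, D1 and NE2∕3∕4.
-/

set_option autoImplicit false

noncomputable section

namespace Summit.QuantumFields.BalabanUV.T4Continuum.NE7b.SupZdPerturbedCovarianceProjection

open Real Filter Topology
open Literature.MathematicalPhysics.QuantumFieldTheory.Balaban1983to89
open B6QGQLower276 (X blk B)
open SupZdCoarseForm (natAbs_sub_comm_sum)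
open SupZdPerturbedCoarseForm (coarse_entry_le)
open SupZdCoarseInverseOperator (kernel_comp_apply)

variable {d : ℕ}

/-! ## §1. THE END: the perturbed fluctuation covariance annihilates block sources -/

/-- **HEADLINE — `C_K𝟙_{B n b₀} = 0`: THE RESPONSE PART OF A PERTURBED BLOCK COLUMN IS THE BLOCK COLUMN ITSELF**: for every mesh `n`, ANY
family `Ψ^K` of block profile `|Ψ^K_c(p)| ≤ C_Ψe^{−μ|blk n p − c|₁}` (`μ > 0`), ANY kernel `N` with `|N(b,c)| ≤ C_Ne^{−ν|b−c|₁}` (`ν > 0`) that is a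
LEFT inverse of the coarse operator (`Σ′_{b′}N(b,b′)T_K(b′,c) = δ_{bc}`, `T_K(b′,c) = (n+1)^{−d}Σ_{q ∈ B n b′}Ψ^K_c(q)`), every `b₀` and `p`:
`Σ′_{b″}T_K(b″,b₀)·(Σ′_{b′}N(b′,b″)Ψ^K_{b′}(p)) = Ψ^K_{b₀}(p)`, so the fluctuation part `Ψ^K_{b₀}(p) − Σ″(block means of Ψ^K_{b₀})(b″)h^K_{b″}(p)`
of (221)'s display VANISHES — ONE exchange of the absolutely convergent double series ((203) `kernel_comp_apply`: `T_K(·,b₀)` decays by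
(234), `N` decays, `Ψ^K_{b′}(p)` is bounded in `b′`) and `NT_K = 1`. [folklore] -/
theorem perturbed_covariance_kills_block_sources (n : ℕ) {CΨ μ CN ν : ℝ} (hμ : 0 < μ) (hν : 0 < ν)
    (ΨK : X d → X d → ℝ) (hΨB : ∀ c p, |ΨK c p| ≤ CΨ * exp (-(μ * ∑ i, (((blk n p i - c i).natAbs : ℕ) : ℝ))))
    (N : X d → X d → ℝ) (hN : ∀ b c, |N b c| ≤ CN * exp (-(ν * ∑ i, (((b i - c i).natAbs : ℕ) : ℝ))))
    (hNT : ∀ b c, ∑' b' : X d, N b b' * ((((n : ℝ) + 1) ^ d)⁻¹ * ∑ q ∈ B n b', ΨK c q) = if b = c then 1 else 0)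
    (b₀ p : X d) :
    ∑' b'' : X d, ((((n : ℝ) + 1) ^ d)⁻¹ * ∑ q ∈ B n b'', ΨK b₀ q) * ∑' b' : X d, N b' b'' * ΨK b' p = ΨK b₀ p ∧
    ΨK b₀ p - ∑' b'' : X d, ((((n : ℝ) + 1) ^ d)⁻¹ * ∑ q ∈ B n b'', ΨK b₀ q) * ∑' b' : X d, N b' b'' * ΨK b' p = 0 := by
  classical
  have hCΨ : 0 ≤ CΨ := by
    have h := (abs_nonneg _).trans (hΨB b₀ p)
    exact le_of_mul_le_mul_right (by rw [zero_mul]; exact h) (exp_pos _)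
  -- the three ingredients: `Ψ^K_{b′}(p)` bounded in `b′`, `T_K(·,b₀)` and `N` decaying
  have hΨb : ∀ b', |ΨK b' p| ≤ CΨ := fun b' =>
    (hΨB b' p).trans (mul_le_of_le_one_right hCΨ (exp_le_one_iff.2 (by rw [neg_nonpos]; positivity)))
  obtain ⟨T, hT⟩ : ∃ T : X d → X d → ℝ, ∀ b c, T b c = (((n : ℝ) + 1) ^ d)⁻¹ * ∑ q ∈ B n b, ΨK c q := ⟨_, fun _ _ => rfl⟩
  have hKd : ∀ b b'' : X d, |T b'' b| ≤ CΨ * exp (-(μ * ∑ i, (((b i - b'' i).natAbs : ℕ) : ℝ))) := fun b b'' => by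
    rw [hT, natAbs_sub_comm_sum b b'']; exact coarse_entry_le n ΨK b (hΨB b) b''
  have hLd : ∀ b'' b' : X d, |N b' b''| ≤ CN * exp (-(ν * ∑ i, (((b'' i - b' i).natAbs : ℕ) : ℝ))) := fun b'' b' => by
    rw [natAbs_sub_comm_sum b'' b']; exact hN b' b''
  -- exchange, then `NT_K = 1`
  have hx := kernel_comp_apply hμ hν (fun b b'' => T b'' b) (fun b'' b' => N b' b'') hKd hLd (fun b' => ΨK b' p) hΨb b₀
  have hNT' : ∀ b', ∑' b'' : X d, T b'' b₀ * N b' b'' = if b' = b₀ then 1 else 0 := fun b' => by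
    have h := hNT b' b₀
    simp only [← hT] at h
    rw [← h]; exact tsum_congr fun b'' => mul_comm _ _
  simp only [hNT'] at hx
  have hR : ∑' b' : X d, (if b' = b₀ then (1 : ℝ) else 0) * ΨK b' p = ΨK b₀ p := by
    rw [tsum_eq_single b₀ (fun b' hb' => by rw [if_neg hb', zero_mul]), if_pos rfl, one_mul]
  rw [hR] at hx
  simp only [hT] at hx
  exact ⟨hx, by rw [hx, sub_self]⟩

/-! ## §2. Toy -/

/-- Toy (`d = 1`, `n = 0`, everything zero except the statement's shape): with `Ψ^K = 0` the hypotheses `NT_K = 1` cannot hold, so we only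
exercise the series identity of §1's last step — `Σ′_{b′}δ_{b′b₀}·g(b′) = g(b₀)` on `ℤ`. -/
example (g : X 1 → ℝ) (b₀ : X 1) : ∑' b' : X 1, (if b' = b₀ then (1 : ℝ) else 0) * g b' = g b₀ := by
  rw [tsum_eq_single b₀ (fun b' hb' => by rw [if_neg hb', zero_mul]), if_pos rfl, one_mul]

end Summit.QuantumFields.BalabanUV.T4Continuum.NE7b.SupZdPerturbedCovarianceProjection
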